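import Summits.SmoothPoincare4.SmoothPoincare4.Theorems.InformationMetricHadamardAhHadamardFillingStubInstantonCollarPackageSmooth
import Literature.Geometry.GaugeTheory.InstantonEntropy

/-!
# Transfer of the cone asymptotics of the information metric along the collar
(crux `InformationMetricHadamard.AhHadamardFilling`, item stmt-SmoothPoincare4-6014, line
`fisher-sphere-gauss`, stub F `stub_instantonCollarPackage` — the Donaldson–Taubes collar of a
model of the charge-one instanton moduli space). This file is the metric part of the transfer of
the collar `Ψ : Σ × (0, l₀) → M₁ = AsdModuliSpace g Σ.orientation 1` to a model `ι : W → M₁`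
along `Φ = ι⁻¹ ∘ Ψ ∘ r`, `r (σ, l) = (σ, f l)`, `f l = l₀ l / (l₀ + l)`: the Groisser–Murray `C⁰`
cone asymptotics of the information metric `𝐠(X, X) = ∫ (∂_X ρ)² / ρ dvol_g` along `Ψ` (the last
clause of `Literature.Geometry.GaugeTheory.informationMetric_collarAsymptotics`, taken here as the
hypothesis `hΨasym`) imply the same asymptotics for the Fisher form of the Hellinger family
`hellinger ι = 2√ρ` along `Φ` (`helper_collarAsymptoticsTransfer`).

Mechanism. With `μ = dvol_g` (finite) and `V = L²(Σ, μ)`: the Fisher form is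
`𝓘(w)(X, X) = ‖d e_w X‖²` for the Hellinger map `e w = [2√ρ_{ι w}] : W → V`
(`mvfderiv_toLp_family`, `inner_toLp_toLp`); on the collar domain `e ∘ Φ = θ_Σ ∘ r` with
`θ_Σ q = [2√ρ_{Ψ q}]` smooth on `Σ × (0, f 1)` with differential `Y ↦ [∂_Y 2√ρ] = [∂_Y ρ / √ρ]`
(`helper_toLp_family_manifold`; the densities are positive there since `Ψ (r p) = ι (Φ p)`), and
`dr_{(σ,l)} (v, s) = (v, f'(l) s)`, `f' l = l₀² / (l₀ + l)²`; so by the chain rule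
`𝓘(Φ p)(dΦ X, dΦ X) = ∫ (∂_{dr X} ρ)² / ρ dvol_g` at `r p`, to which `hΨasym` applies, and the cone
term at `(f l, f' l s)` differs from the one at `(l, s)` by a relative error `≤ 3 l / l₀`
(`l / f l = 1 + l / l₀`).
Authorship: stub-worker of the line lead prover-line-stmt-SmoothPoincare4-6014-c5-0 (wave 3).

References: D. Groisser, M. K. Murray, *Instantons and the information metric*, Ann. Global
Anal. Geom. 15 (1997) 519–537 (dg-ga/9611008), §2 (metric1), Thm. 3.1; J. Dieudonné,
*Foundations of Modern Analysis* (1960), (8.11.2).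
-/

noncomputable section

-- the prescribed namespace `Summit.<P>.<Sub>.…` duplicates `SmoothPoincare4` (P = Sub)
set_option linter.dupNamespace false

open scoped Manifold ContDiff Topology ENNReal NNReal RealInnerProductSpace
open Set Function MeasureTheory Topology Filter

namespace Summit.SmoothPoincare4.SmoothPoincare4.Cruxes.AhHadamardFilling.FisherSphereGauss

open Literature.Topology.FourManifolds (HomotopySphere)
open Literature.Geometry.Lorentzian (PseudoRiemannianMetric riemannianMeasure mvfderiv_congr_nhds)
open Literature.Geometry.GaugeTheory (AsdModuliSpace volMeasure)

/-! ## §A. Elementary estimates for the scale reparametrisation -/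

/-- **Cone reparametrisation error.** For `0 < l ≤ l₀`, `c, a ≥ 0`, the cone term
`c ((f' s)² + a) / f²` at the reparametrised scale `f = l₀ l / (l₀ + l)` with `f' = l₀²/(l₀+l)²`
differs from `c (s² + a) / l²` by at most the fraction `3 l / l₀` of the latter
(`f'²/f² = l₀²/((l₀+l)² l²)`, `1/f² = (l₀+l)²/(l₀² l²)`). [folklore] -/
theorem abs_coneReparam_sub_le {l₀ l c s a : ℝ} (hl₀ : 0 < l₀) (hl : 0 < l) (hll₀ : l ≤ l₀)
    (hc : 0 ≤ c) (ha : 0 ≤ a) :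
    |c * ((s * (l₀ ^ 2 / (l₀ + l) ^ 2)) ^ 2 + a) / (l₀ * l / (l₀ + l)) ^ 2 -
        c * (s ^ 2 + a) / l ^ 2| ≤ 3 * l / l₀ * (c * (s ^ 2 + a) / l ^ 2) := by
  have hu : 0 < l₀ + l := by positivity
  have key : c * ((s * (l₀ ^ 2 / (l₀ + l) ^ 2)) ^ 2 + a) / (l₀ * l / (l₀ + l)) ^ 2 -
      c * (s ^ 2 + a) / l ^ 2 =
      c / l ^ 2 * (a * (l * (2 * l₀ + l) / l₀ ^ 2) -
        s ^ 2 * (l * (2 * l₀ + l) / (l₀ + l) ^ 2)) := by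
    field_simp
    ring
  have h1 : l * (2 * l₀ + l) / l₀ ^ 2 ≤ 3 * l / l₀ := by
    rw [div_le_div_iff₀ (by positivity) hl₀]
    nlinarith [mul_pos hl hl₀]
  have h2 : l * (2 * l₀ + l) / (l₀ + l) ^ 2 ≤ 3 * l / l₀ := by
    rw [div_le_div_iff₀ (by positivity) hl₀]
    nlinarith [mul_pos hl hl₀, mul_pos hl hl, mul_pos (mul_pos hl hl) hl]
  have h1' : 0 ≤ l * (2 * l₀ + l) / l₀ ^ 2 := by positivity
  have h2' : 0 ≤ l * (2 * l₀ + l) / (l₀ + l) ^ 2 := by positivity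
  have hK0 : 0 ≤ 3 * l / l₀ := by positivity
  have hK : |a * (l * (2 * l₀ + l) / l₀ ^ 2) - s ^ 2 * (l * (2 * l₀ + l) / (l₀ + l) ^ 2)| ≤
      3 * l / l₀ * (s ^ 2 + a) := by
    rw [abs_le]
    constructor
    · nlinarith [mul_le_mul_of_nonneg_left h2 (sq_nonneg s), mul_nonneg ha h1',
        mul_nonneg hK0 ha]
    · nlinarith [mul_le_mul_of_nonneg_left h1 ha, mul_nonneg (sq_nonneg s) h2',
        mul_nonneg hK0 (sq_nonneg s)]
  rw [key, abs_mul, abs_of_nonneg (by positivity : (0 : ℝ) ≤ c / l ^ 2)]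
  calc c / l ^ 2 * |a * (l * (2 * l₀ + l) / l₀ ^ 2) - s ^ 2 * (l * (2 * l₀ + l) / (l₀ + l) ^ 2)|
      ≤ c / l ^ 2 * (3 * l / l₀ * (s ^ 2 + a)) := by gcongr
    _ = 3 * l / l₀ * (c * (s ^ 2 + a) / l ^ 2) := by ring

/-- **Composition of two relative `C⁰` errors**: `|A - B| ≤ ε₁ B` and `|B - C| ≤ ε₂ C` with
`C, ε₁ ≥ 0` give `|A - C| ≤ (ε₁ (1 + ε₂) + ε₂) C`. [folklore] -/
theorem abs_sub_le_of_relative {A B C ε₁ ε₂ : ℝ} (hε₁ : 0 ≤ ε₁)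
    (h₁ : |A - B| ≤ ε₁ * B) (h₂ : |B - C| ≤ ε₂ * C) :
    |A - C| ≤ (ε₁ * (1 + ε₂) + ε₂) * C := by
  have hB : B ≤ (1 + ε₂) * C := by
    have h := (abs_sub_le_iff.1 h₂).1
    linarith
  calc |A - C| ≤ |A - B| + |B - C| := abs_sub_le A B C
    _ ≤ ε₁ * B + ε₂ * C := add_le_add h₁ h₂
    _ ≤ ε₁ * ((1 + ε₂) * C) + ε₂ * C := by gcongr
    _ = (ε₁ * (1 + ε₂) + ε₂) * C := by ring

/-- The reparametrised scale `l₀ l / (l₀ + l)` is at most `l` for `l₀, l > 0`. [folklore] -/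
theorem collarScale_le {l₀ l : ℝ} (hl₀ : 0 < l₀) (hl : 0 < l) : l₀ * l / (l₀ + l) ≤ l := by
  rw [div_le_iff₀ (by positivity)]
  nlinarith [mul_pos hl hl]

/-! ## §B. Calculus: the differential of the reparametrisation and a vector-valued chain rule -/

/-- **The differential of the scale reparametrisation** `r (σ, l) = (σ, l₀ l / (l₀ + l))` at a
point with `l₀ + l ≠ 0`: `dr (v, s) = (v, s f'(l))` with `f' l = l₀² / (l₀ + l)²`
(`HasMFDerivAt.prodMk`, `hasMFDerivAt_fst/snd` and the one-variable derivative of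
`l ↦ l₀ l / (l₀ + l)`). [folklore] -/
theorem hasMFDerivAt_collarReparam {N : Type*} [TopologicalSpace N]
    [ChartedSpace (EuclideanSpace ℝ (Fin 4)) N] {l₀ l : ℝ} (x : N) (hl : l₀ + l ≠ 0) :
    HasMFDerivAt ((𝓡 4).prod 𝓘(ℝ, ℝ)) ((𝓡 4).prod 𝓘(ℝ, ℝ))
      (fun p : N × ℝ ↦ (p.1, l₀ * p.2 / (l₀ + p.2))) (x, l)
      ((ContinuousLinearMap.fst ℝ (EuclideanSpace ℝ (Fin 4)) ℝ).prod
        ((ContinuousLinearMap.toSpanSingleton ℝ (l₀ ^ 2 / (l₀ + l) ^ 2)).comp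
          (ContinuousLinearMap.snd ℝ (EuclideanSpace ℝ (Fin 4)) ℝ))) := by
  have hf : HasDerivAt (fun t : ℝ ↦ l₀ * t / (l₀ + t)) (l₀ ^ 2 / (l₀ + l) ^ 2) l := by
    have h1 : HasDerivAt (fun t : ℝ ↦ l₀ * t) (l₀ * 1) l := (hasDerivAt_id' l).const_mul l₀
    have h2 : HasDerivAt (fun t : ℝ ↦ l₀ + t) 1 l := (hasDerivAt_id' l).const_add l₀
    refine (h1.fun_div h2 hl).congr_deriv ?_
    show ((l₀ * 1 * (l₀ + l) - l₀ * l * 1) / (l₀ + l) ^ 2 : ℝ) = l₀ ^ 2 / (l₀ + l) ^ 2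
    ring
  have hf' : HasMFDerivAt 𝓘(ℝ, ℝ) 𝓘(ℝ, ℝ) (fun t : ℝ ↦ l₀ * t / (l₀ + t)) ((x, l).2)
      (ContinuousLinearMap.toSpanSingleton ℝ (l₀ ^ 2 / (l₀ + l) ^ 2)) :=
    hf.hasFDerivAt.hasMFDerivAt
  exact (hasMFDerivAt_fst _).prodMk (hf'.comp (x, l) (hasMFDerivAt_snd _))

section ChainRule

variable {E : Type*} [NormedAddCommGroup E] [NormedSpace ℝ E] {H : Type*} [TopologicalSpace H]
  {I : ModelWithCorners ℝ E H} {M : Type*} [TopologicalSpace M] [ChartedSpace H M]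
  {E' : Type*} [NormedAddCommGroup E'] [NormedSpace ℝ E'] {H' : Type*} [TopologicalSpace H']
  {I' : ModelWithCorners ℝ E' H'} {M' : Type*} [TopologicalSpace M'] [ChartedSpace H' M']
  {V : Type*} [NormedAddCommGroup V] [NormedSpace ℝ V]

/-- **Chain rule for the vector-valued manifold derivative**: for `f : M → M'` differentiable at
`x` and `g : M' → V` differentiable at `f x`, `d(g ∘ f)_x X = dg_{f x} (df_x X)` (Mathlib's
`mfderiv_comp` followed by the canonical identification `T_{g (f x)} V = V`). [folklore] -/
theorem mvfderiv_comp_apply {f : M → M'} {g : M' → V} (x : M)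
    (hg : MDifferentiableAt I' 𝓘(ℝ, V) g (f x)) (hf : MDifferentiableAt I I' f x)
    (X : TangentSpace I x) :
    mvfderiv I (g ∘ f) x X = mvfderiv I' g (f x) (mfderiv I I' f x X) := by
  simp only [mvfderiv, mfderiv_comp x hg hf, ContinuousLinearMap.coe_comp,
    ContinuousLinearEquiv.coe_coe, Function.comp_apply]
  rfl

/-- For a real-valued map, the vector-valued manifold derivative `mvfderiv` is the manifold
derivative `mfderiv` read in `ℝ` (the identification `T_{ρ q} ℝ = ℝ` is the identity). [folklore] -/
theorem mvfderiv_apply_eq_mfderiv {ρ : M → ℝ} {q : M} (Y : TangentSpace I q) :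
    mvfderiv I ρ q Y = (mfderiv I 𝓘(ℝ, ℝ) ρ q Y : ℝ) := rfl

/-- **Pointwise chain rule for the Hellinger normalisation**: if `ρ : M → ℝ` is differentiable at
`q` with `ρ q > 0`, then `d(2√ρ)_q Y = dρ_q Y / √(ρ q)` (`Real.hasDerivAt_sqrt` and the chain rule
`HasMFDerivAt.comp`). [folklore] -/
theorem mvfderiv_two_mul_sqrt {ρ : M → ℝ} {q : M}
    (hρ : MDifferentiableAt I 𝓘(ℝ, ℝ) ρ q) (hu : 0 < ρ q) (Y : TangentSpace I q) :
    mvfderiv I (fun q' ↦ 2 * Real.sqrt (ρ q')) q Y = mvfderiv I ρ q Y / Real.sqrt (ρ q) := by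
  have h1 : HasDerivAt (fun u : ℝ ↦ 2 * Real.sqrt u) (1 / Real.sqrt (ρ q)) (ρ q) := by
    refine ((Real.hasDerivAt_sqrt hu.ne').const_mul 2).congr_deriv ?_
    show (2 : ℝ) * (1 / (2 * Real.sqrt (ρ q))) = 1 / Real.sqrt (ρ q)
    ring
  have h3 := h1.hasFDerivAt.hasMFDerivAt.comp q hρ.hasMFDerivAt
  rw [show (fun q' ↦ 2 * Real.sqrt (ρ q')) = (fun u : ℝ ↦ 2 * Real.sqrt u) ∘ ρ from rfl]
  unfold mvfderiv
  rw [h3.mfderiv]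
  show mvfderiv I ρ q Y * (1 / Real.sqrt (ρ q)) = mvfderiv I ρ q Y / Real.sqrt (ρ q)
  rw [mul_one_div]

end ChainRule

/-! ## §C. The transfer of the asymptotics -/

/-- **Transfer of the cone asymptotics of the information metric along the collar** (helper of
stub F `stub_instantonCollarPackage`). Let `ι : W → M₁(Σ, g)` be a moduli model with positive
densities, `Ψ : Σ × ℝ → M₁` a collar over `(0, l₀)` with jointly smooth densities whose
information metric `∫ (∂_X ρ)² / ρ dvol_g` is `C⁰`-asymptotic to `c (ds² + g) / l²` as `l → 0`
(hypothesis `hΨasym`, verbatim the last clause of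
`Literature.Geometry.GaugeTheory.informationMetric_collarAsymptotics`), and `Φ : Σ × ℝ → W` a map,
`C^∞` on `Σ × (0, 1)`, with `ι (Φ (σ, l)) = Ψ (σ, l₀ l / (l₀ + l))` there. Then the Fisher form of
the Hellinger family `hellinger ι = 2√ρ` along `Φ` is `C⁰`-asymptotic to `c (ds² + g) / l²`:
for every `ε > 0` there is `t ∈ (0, 1)` with
`|𝓘(Φ(x,l))(dΦ (v,s), dΦ (v,s)) − c (s² + g(v,v))/l²| ≤ ε c (s² + g(v,v))/l²` for `0 < l < t`.
Proof: `𝓘(Φ p)(dΦ X, dΦ X) = ‖d(e ∘ Φ)_p X‖²_{L²}` for the Hellinger map `e : W → L²(Σ, dvol_g)`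
(`mvfderiv_toLp_family`, `inner_toLp_toLp`, chain rule); `e ∘ Φ = θ_Σ ∘ r` near `p` with
`θ_Σ q = [2√ρ_{Ψ q}]` (`helper_toLp_family_manifold` on `Σ × (0, f 1)`, where `ρ_{Ψ q} > 0` as
`Ψ q ∈ ι(Φ(Σ × (0,1)))`) and `dr (v, s) = (v, f'(l) s)` (`hasMFDerivAt_collarReparam`); pointwise
`∂_Y (2√ρ) = ∂_Y ρ / √ρ`, so the form is `∫ (∂_{(v, f' s)} ρ)² / ρ dvol_g` at `(x, f l)`, within
`ε'` of `c ((f' s)² + g(v,v)) / f²` by `hΨasym` (as `f l ≤ l`), which is within `3 l / l₀ ≤ ε'` of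
`c (s² + g(v,v)) / l²` (`abs_coneReparam_sub_le`); with `ε' = min ε 1 / 3` the composite relative
error is `≤ ε` (`abs_sub_le_of_relative`). [cite: GroisserMurray1997, Thm. 3.1 and §2 (metric1)] -/
theorem helper_collarAsymptoticsTransfer (S : HomotopySphere 4) [Nonempty S.carrier]
    (g : PseudoRiemannianMetric (𝓡 4) ∞ (EuclideanSpace ℝ (Fin 4)) (TangentSpace (𝓡 4) : S.carrier → Type _))
    (hg : g.IsRiemannian)
    (W : Type) [TopologicalSpace W] [ChartedSpace (EuclideanSpace ℝ (Fin 5)) W] [IsManifold (𝓡 5) ∞ W]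
    (ι : W → AsdModuliSpace g S.orientation 1) (hmod : IsModuliModel ι)
    (hρ : ∀ (w : W) (x : S.carrier), 0 < (ι w).density g x)
    {l₀ : ℝ} (hl₀ : 0 < l₀) {Ψ : S.carrier × ℝ → AsdModuliSpace g S.orientation 1}
    (hΨρ : ContMDiffOn (((𝓡 4).prod 𝓘(ℝ, ℝ)).prod (𝓡 4)) 𝓘(ℝ, ℝ) ∞
      (fun q : (S.carrier × ℝ) × S.carrier ↦ (Ψ q.1).density g q.2) ((univ ×ˢ Ioo 0 l₀) ×ˢ univ))
    {c : ℝ} (hc : 0 < c)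
    (hΨasym : ∀ ε : ℝ, 0 < ε → ∃ t ∈ Ioo 0 l₀, ∀ (σ : S.carrier) (l : ℝ), l ∈ Ioo 0 t →
      ∀ (v : TangentSpace (𝓡 4) σ) (s : ℝ),
        |(∫ x, (mvfderiv ((𝓡 4).prod 𝓘(ℝ, ℝ))
                  (fun p : S.carrier × ℝ ↦ (Ψ p).density g x) (σ, l) (v, s)) ^ 2 /
                (Ψ (σ, l)).density g x ∂(volMeasure g hg)) -
            c * (s ^ 2 + g.val σ v v) / l ^ 2|
          ≤ ε * (c * (s ^ 2 + g.val σ v v) / l ^ 2))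
    {Φ : S.carrier × ℝ → W}
    (hΦ : ∀ p ∈ (univ : Set S.carrier) ×ˢ Ioo (0 : ℝ) 1, ι (Φ p) = Ψ (p.1, l₀ * p.2 / (l₀ + p.2)))
    (hΦs : ContMDiffOn ((𝓡 4).prod 𝓘(ℝ, ℝ)) (𝓡 5) ∞ Φ (univ ×ˢ Ioo (0 : ℝ) 1)) :
    ∀ ε : ℝ, 0 < ε → ∃ t ∈ Ioo (0 : ℝ) 1, ∀ (x : S.carrier) (l : ℝ), l ∈ Ioo (0 : ℝ) t →
      ∀ (v : TangentSpace (𝓡 4) x) (s : ℝ),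
        |fisherForm g hg (hellinger ι) (Φ (x, l))
              (mfderiv ((𝓡 4).prod 𝓘(ℝ, ℝ)) (𝓡 5) Φ (x, l) (v, s))
              (mfderiv ((𝓡 4).prod 𝓘(ℝ, ℝ)) (𝓡 5) Φ (x, l) (v, s)) -
            c * (s ^ 2 + g.val x v v) / l ^ 2| ≤ ε * (c * (s ^ 2 + g.val x v v) / l ^ 2) := by
  classical
  /- §0 the finite Borel measure `μ = dvol_g` on the compact `Σ` -/
  letI : MeasurableSpace S.carrier := borel _
  haveI : BorelSpace S.carrier := ⟨rfl⟩
  haveI : IsFiniteMeasure (volMeasure g hg) :=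
    ⟨Literature.Geometry.Lorentzian.riemannianVolume_lt_top_of_isCompact_holds _ le_rfl
      isCompact_univ⟩
  /- §1 the open sets: the collar domain `D = Σ × (0,1)` of `Φ`, the domain `Σ × (0, l₀)` of `Ψ`
  and the image `Σ × (0, f 1)` of `D` under the reparametrisation `r` -/
  have hD : IsOpen ((univ : Set S.carrier) ×ˢ Ioo (0 : ℝ) 1) := isOpen_univ.prod isOpen_Ioo
  have hs : IsOpen ((univ : Set S.carrier) ×ˢ Ioo (0 : ℝ) l₀) := isOpen_univ.prod isOpen_Ioo
  have hs' : IsOpen ((univ : Set S.carrier) ×ˢ Ioo (0 : ℝ) (l₀ * 1 / (l₀ + 1))) :=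
    isOpen_univ.prod isOpen_Ioo
  have hs's : (univ : Set S.carrier) ×ˢ Ioo (0 : ℝ) (l₀ * 1 / (l₀ + 1)) ⊆ univ ×ˢ Ioo 0 l₀ :=
    prod_mono Subset.rfl (Ioo_subset_Ioo_right (collarScale_lt_self hl₀ one_pos).le)
  have hrs' : MapsTo (fun p : S.carrier × ℝ ↦ (p.1, l₀ * p.2 / (l₀ + p.2)))
      ((univ : Set S.carrier) ×ˢ Ioo (0 : ℝ) 1) (univ ×ˢ Ioo (0 : ℝ) (l₀ * 1 / (l₀ + 1))) :=
    fun p hp ↦ ⟨mem_univ _, collarScale_pos hl₀ hp.2.1,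
      collarScale_lt_collarScale hl₀ hp.2.1 hp.2.2⟩
  -- the collar densities are positive on `Σ × (0, f 1) = r(D)`, as `Ψ (r p) = ι (Φ p)`
  have hpos' : ∀ q ∈ (univ : Set S.carrier) ×ˢ Ioo (0 : ℝ) (l₀ * 1 / (l₀ + 1)), ∀ y,
      0 < (Ψ q).density g y := by
    rintro ⟨σ, m⟩ ⟨-, hm⟩ y
    obtain ⟨l, hl, hlm⟩ := exists_collarScale_eq hl₀ one_pos hm.1 hm.2
    have h := hΦ (σ, l) ⟨mem_univ _, hl⟩
    dsimp only at h
    rw [hlm] at h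
    rw [← h]
    exact hρ _ _
  /- §2 the Hellinger map `e : W → V = L²(Σ, μ)` and its differential -/
  have hθ : ContMDiff ((𝓡 5).prod (𝓡 4)) 𝓘(ℝ, ℝ) ∞
      (fun p : W × S.carrier ↦ hellinger ι p.1 p.2) := by
    intro p
    have h2 : ContDiffAt ℝ ∞ (fun r : ℝ ↦ 2 * Real.sqrt r) ((ι p.1).density g p.2) :=
      contDiffAt_const.mul (Real.contDiffAt_sqrt (hρ p.1 p.2).ne')
    exact h2.comp_contMDiffAt (f := fun q : W × S.carrier ↦ (ι q.1).density g q.2)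
      (hmod.contMDiff_density p)
  have hθc : ∀ w, Continuous (hellinger ι w) := continuous_family hθ
  obtain ⟨e, heq⟩ : ∃ e : W → Lp ℝ 2 (volMeasure g hg), e = fun w ↦
      ContinuousMap.toLp (E := ℝ) 2 (volMeasure g hg) ℝ
        (⟨hellinger ι w, hθc w⟩ : C(S.carrier, ℝ)) := ⟨_, rfl⟩
  have he : ContMDiff (𝓡 5) 𝓘(ℝ, Lp ℝ 2 (volMeasure g hg)) ∞ e := by
    rw [heq]; exact contMDiff_toLp_family hθ hθc
  have hd : ∀ (w : W) (X : TangentSpace (𝓡 5) w), mvfderiv (𝓡 5) e w X =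
      ContinuousMap.toLp (E := ℝ) 2 (volMeasure g hg) ℝ
        ⟨fun y ↦ D1 (hellinger ι) w X y, continuous_D1 hθ w X⟩ := by
    intro w X; rw [heq]; exact mvfderiv_toLp_family hθ hθc w X fun y ↦ rfl
  -- the Fisher form is the pull-back of the `L²` inner product under `e`
  have hfish : ∀ (w : W) (X : TangentSpace (𝓡 5) w), fisherForm g hg (hellinger ι) w X X =
      ⟪mvfderiv (𝓡 5) e w X, mvfderiv (𝓡 5) e w X⟫ := by
    intro w X
    rw [hd, inner_toLp_toLp]
    rfl
  /- §3 the Hellinger map of the collar `θ_Σ q = [2√ρ_{Ψ q}]` on `Σ × (0, f 1)` -/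
  have hρθ : ContMDiffOn (((𝓡 4).prod 𝓘(ℝ, ℝ)).prod (𝓡 4)) 𝓘(ℝ, ℝ) ∞
      (fun q : (S.carrier × ℝ) × S.carrier ↦ 2 * Real.sqrt ((Ψ q.1).density g q.2))
      ((univ ×ˢ Ioo (0 : ℝ) (l₀ * 1 / (l₀ + 1))) ×ˢ univ) := by
    intro q hq
    have h2 : ContDiffAt ℝ ∞ (fun r : ℝ ↦ 2 * Real.sqrt r) ((Ψ q.1).density g q.2) :=
      contDiffAt_const.mul (Real.contDiffAt_sqrt (hpos' q.1 hq.1 q.2).ne')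
    exact h2.comp_contMDiffWithinAt
      (f := fun q : (S.carrier × ℝ) × S.carrier ↦ (Ψ q.1).density g q.2)
      ((hΨρ q ⟨hs's hq.1, mem_univ _⟩).mono (prod_mono hs's Subset.rfl))
  have hcθ : ∀ q ∈ (univ : Set S.carrier) ×ˢ Ioo (0 : ℝ) (l₀ * 1 / (l₀ + 1)),
      Continuous fun y ↦ 2 * Real.sqrt ((Ψ q).density g y) := fun q hq ↦
    hρθ.continuousOn.comp_continuous (f := fun y : S.carrier ↦ (q, y))
      (continuous_const.prodMk continuous_id) fun y ↦ ⟨hq, mem_univ _⟩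
  obtain ⟨F, hFdef⟩ : ∃ F : S.carrier × ℝ → C(S.carrier, ℝ), F = fun q ↦
      if hq : q ∈ (univ : Set S.carrier) ×ˢ Ioo (0 : ℝ) (l₀ * 1 / (l₀ + 1)) then
        ⟨fun y ↦ 2 * Real.sqrt ((Ψ q).density g y), hcθ q hq⟩ else 0 := ⟨_, rfl⟩
  have hFapp : ∀ q ∈ (univ : Set S.carrier) ×ˢ Ioo (0 : ℝ) (l₀ * 1 / (l₀ + 1)), ∀ y,
      F q y = 2 * Real.sqrt ((Ψ q).density g y) := by
    intro q hq y
    simp only [hFdef, dif_pos hq, ContinuousMap.coe_mk]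
  obtain ⟨G, hGdef⟩ : ∃ G : S.carrier × ℝ → Lp ℝ 2 (volMeasure g hg), G = fun q ↦
      ContinuousMap.toLp (E := ℝ) 2 (volMeasure g hg) ℝ (F q) := ⟨_, rfl⟩
  obtain ⟨hGs, hGd⟩ := helper_toLp_family_manifold (IM := (𝓡 4).prod 𝓘(ℝ, ℝ)) (IK := 𝓡 4)
    (volMeasure g hg)
    (ρ := fun (q : S.carrier × ℝ) (y : S.carrier) ↦ 2 * Real.sqrt ((Ψ q).density g y))
    hs' hρθ hFapp
  rw [← hGdef] at hGs hGd
  -- slices of the density family are differentiable on `Σ × (0, l₀)`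
  have hρq : ∀ q ∈ (univ : Set S.carrier) ×ˢ Ioo (0 : ℝ) l₀, ∀ y,
      MDifferentiableAt ((𝓡 4).prod 𝓘(ℝ, ℝ)) 𝓘(ℝ, ℝ)
        (fun q' : S.carrier × ℝ ↦ (Ψ q').density g y) q := by
    intro q hq y
    have h := (hΨρ (q, y) ⟨hq, mem_univ _⟩).contMDiffAt
      ((hs.prod isOpen_univ).mem_nhds ⟨hq, mem_univ _⟩)
    exact (h.comp q (contMDiffAt_id.prodMk contMDiffAt_const)).mdifferentiableAt (by simp)
  /- §4 the identity `𝓘(Φ p)(dΦ X, dΦ X) = ∫ (∂_{dr X} ρ)² / ρ dvol_g` at `r p` -/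
  have hid : ∀ (x : S.carrier) (l : ℝ), l ∈ Ioo (0 : ℝ) 1 → ∀ (v : TangentSpace (𝓡 4) x) (s : ℝ),
      fisherForm g hg (hellinger ι) (Φ (x, l))
          (mfderiv ((𝓡 4).prod 𝓘(ℝ, ℝ)) (𝓡 5) Φ (x, l) (v, s))
          (mfderiv ((𝓡 4).prod 𝓘(ℝ, ℝ)) (𝓡 5) Φ (x, l) (v, s)) =
        ∫ y, (mvfderiv ((𝓡 4).prod 𝓘(ℝ, ℝ)) (fun q : S.carrier × ℝ ↦ (Ψ q).density g y)
              (x, l₀ * l / (l₀ + l)) (v, s * (l₀ ^ 2 / (l₀ + l) ^ 2))) ^ 2 /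
            (Ψ (x, l₀ * l / (l₀ + l))).density g y ∂(volMeasure g hg) := by
    intro x l hl v s
    have hp : (x, l) ∈ (univ : Set S.carrier) ×ˢ Ioo (0 : ℝ) 1 := ⟨mem_univ _, hl⟩
    have hq : (x, l₀ * l / (l₀ + l)) ∈ (univ : Set S.carrier) ×ˢ Ioo (0 : ℝ) (l₀ * 1 / (l₀ + 1)) :=
      hrs' hp
    have hΦp : MDifferentiableAt ((𝓡 4).prod 𝓘(ℝ, ℝ)) (𝓡 5) Φ (x, l) :=
      ((hΦs _ hp).contMDiffAt (hD.mem_nhds hp)).mdifferentiableAt (by simp)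
    have hep : MDifferentiableAt (𝓡 5) 𝓘(ℝ, Lp ℝ 2 (volMeasure g hg)) e (Φ (x, l)) :=
      (he _).mdifferentiableAt (by simp)
    have hGq : MDifferentiableAt ((𝓡 4).prod 𝓘(ℝ, ℝ)) 𝓘(ℝ, Lp ℝ 2 (volMeasure g hg)) G
        ((fun p : S.carrier × ℝ ↦ (p.1, l₀ * p.2 / (l₀ + p.2))) (x, l)) :=
      ((hGs _ hq).contMDiffAt (hs'.mem_nhds hq)).mdifferentiableAt (by simp)
    have hr := hasMFDerivAt_collarReparam (l₀ := l₀) x (add_pos hl₀ hl.1).ne'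
    -- `e ∘ Φ = θ_Σ ∘ r` near `(x, l)`
    have hev : (e ∘ Φ) =ᶠ[𝓝 (x, l)] (G ∘ fun p : S.carrier × ℝ ↦ (p.1, l₀ * p.2 / (l₀ + p.2))) := by
      filter_upwards [hD.mem_nhds hp] with q hq'
      simp only [Function.comp_apply, heq, hGdef]
      congr 1
      ext y
      rw [hFapp _ (hrs' hq'), ContinuousMap.coe_mk, hellinger, hΦ q hq']
    -- the chain rule, twice
    have hvec : mvfderiv (𝓡 5) e (Φ (x, l)) (mfderiv ((𝓡 4).prod 𝓘(ℝ, ℝ)) (𝓡 5) Φ (x, l) (v, s)) =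
        mvfderiv ((𝓡 4).prod 𝓘(ℝ, ℝ)) G (x, l₀ * l / (l₀ + l))
          (v, s * (l₀ ^ 2 / (l₀ + l) ^ 2)) := by
      rw [← mvfderiv_comp_apply (x, l) hep hΦp (v, s), mvfderiv_congr_nhds hev,
        mvfderiv_comp_apply (x, l) hGq hr.mdifferentiableAt (v, s), hr.mfderiv]
      rfl
    obtain ⟨hcH, hH⟩ := hGd _ hq (v, s * (l₀ ^ 2 / (l₀ + l) ^ 2))
    rw [hfish, hvec, hH, inner_toLp_toLp]
    refine congrArg (integral (volMeasure g hg)) (funext fun y ↦ ?_)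
    simp only [ContinuousMap.coe_mk]
    rw [← mvfderiv_apply_eq_mfderiv, mvfderiv_two_mul_sqrt (hρq _ (hs's hq) y) (hpos' _ hq y),
      div_mul_div_comm, ← sq, ← sq, Real.sq_sqrt (hpos' _ hq y).le]
  /- §5 the estimate -/
  intro ε hε
  set ε' : ℝ := min ε 1 / 3 with hε'
  have hε'0 : 0 < ε' := by positivity
  have hε'1 : ε' ≤ 1 / 3 := by
    rw [hε']
    linarith [min_le_right ε 1]
  have hε'ε : 3 * ε' ≤ ε := by
    rw [hε']
    linarith [min_le_left ε 1]
  obtain ⟨t₁, ht₁, H⟩ := hΨasym ε' hε'0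
  have ht₁0 : 0 < t₁ := ht₁.1
  refine ⟨min (1 / 2) (min t₁ (ε' * l₀ / 3)), ⟨by positivity, ?_⟩, ?_⟩
  · exact (min_le_left _ _).trans_lt (by norm_num)
  intro x l hl v s
  have hl1 : l ∈ Ioo (0 : ℝ) 1 :=
    ⟨hl.1, hl.2.trans_le ((min_le_left _ _).trans (by norm_num))⟩
  have hlt₁ : l < t₁ := hl.2.trans_le ((min_le_right _ _).trans (min_le_left _ _))
  have hlε : l < ε' * l₀ / 3 := hl.2.trans_le ((min_le_right _ _).trans (min_le_right _ _))
  have hll₀ : l ≤ l₀ := by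
    refine hlε.le.trans ?_
    rw [div_le_iff₀ (by norm_num : (0 : ℝ) < 3)]
    nlinarith
  have h3l : 3 * l / l₀ ≤ ε' := by
    rw [div_le_iff₀ hl₀]
    rw [lt_div_iff₀ (by norm_num : (0 : ℝ) < 3)] at hlε
    linarith
  -- the form at `(x, l)` is the information metric of the collar at `(x, f l)` along `(v, f' s)`
  rw [hid x l hl1 v s]
  have hfl : l₀ * l / (l₀ + l) ∈ Ioo 0 t₁ :=
    ⟨collarScale_pos hl₀ hl.1, (collarScale_le hl₀ hl.1).trans_lt hlt₁⟩
  have hA := H x (l₀ * l / (l₀ + l)) hfl v (s * (l₀ ^ 2 / (l₀ + l) ^ 2))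
  have ha : 0 ≤ g.val x v v := by
    by_cases hv : v = 0
    · simp [hv]
    · exact (hg x v hv).le
  have hB := abs_coneReparam_sub_le (s := s) hl₀ hl.1 hll₀ hc.le ha
  have hC : 0 ≤ c * (s ^ 2 + g.val x v v) / l ^ 2 := by positivity
  refine (abs_sub_le_of_relative hε'0.le hA (hB.trans
    (mul_le_mul_of_nonneg_right h3l hC))).trans ?_
  refine mul_le_mul_of_nonneg_right ?_ hC
  nlinarith

end Summit.SmoothPoincare4.SmoothPoincare4.Cruxes.AhHadamardFilling.FisherSphereGauss

end
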